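import Mathlib
import HarnessLib
import Summits.ResolutionOfSingularities.ResolutionOfSingularities.Theorems.WildQuotientsWildQuotientResolutionStubStableAffineCoverBlowup

/-!
# Mumford's hypothesis along a TOWER of equivariant blow-ups (crux stmt-ResolutionOfSingularities-15640
`WildQuotients.WildQuotientResolution`, line `Sketch`; chain w45c `L/w45c/CHAIN.md` v3 rung R1a,
item (1) of `L/res-L1-w45c-stub-2/R1A-TOWER-MEMO.md`)

[OURS · L1 W4.5c; NOT a statement of the manuscript.] The landed
`StableAffineCoverBlowup.stub_stableAffineCoverBlowup` (p151564) gives every point of an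
equivariant blow-up `X♯ → X′` a `G`-stable affine open neighbourhood when `X′` is AFFINE over a
base through a `G`-invariant `q`. For the second and later blow-ups of a tower
`V_m → ⋯ → V₁ → X′` the base `V_i` is no longer affine over the base, but it HAS a `G`-stable affine
cover (by the previous step). `stableAffineCover_of_isBlowup_of_cover` is the same statement with
the `G`-stable affine cover of the base as the hypothesis — so Mumford's hypothesis (the `hcov`
clause of `CyclicTransfer.cyclicDivisorialTransfer`) propagates along any tower of equivariant
blow-ups. Proof verbatim the landed one: the orbit of `x` lies in the blow-up `π⁻¹O → O` of a
`G`-stable affine `O ∋ π x` (`IsBlowup.restrict`), hence in one affine open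
(`exists_isAffineOpen_forall_mem_of_isBlowup`), and the intersection of its translates is
`G`-stable, affine (`IsAffineOpen.iInf`, `X♯` separated) and contains `x`.
-/

-- single-problem summit: the doubled namespace component `ResolutionOfSingularities` is forced
set_option linter.dupNamespace false

noncomputable section

namespace Summit.ResolutionOfSingularities.ResolutionOfSingularities.Theorems.WildQuotientResolution.StableAffineCoverBlowup

open CategoryTheory AlgebraicGeometry TopologicalSpace
open Literature.AlgebraicGeometry.Resolution

/-- **Mumford's hypothesis survives an equivariant blow-up of a base that has it** (tower form of
`stub_stableAffineCoverBlowup`): let `G` (finite) act on the separated locally Noetherian `X`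
with every point in a `G`-stable affine open, and let `π : X♯ → X` be a blow-up (`IsBlowup`)
carrying an action `ρ♯` with `π` equivariant. Then every point of `X♯` has a `G`-stable affine
open neighbourhood. [cite: MumfordAV1970, §7 Thm. p. 66 (proof)] -/
theorem stableAffineCover_of_isBlowup_of_cover {X : Scheme.{0}} [X.IsSeparated]
    [IsLocallyNoetherian X] {G : Type} [Group G] [Finite G] (ρ : G →* Aut X)
    (hcovX : ∀ x : X, ∃ O : X.Opens, IsAffineOpen O ∧ x ∈ O ∧ ∀ g : G, (ρ g).hom ⁻¹ᵁ O = O)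
    {Xs : Scheme.{0}} {π : Xs ⟶ X} {J : X.IdealSheafData} (hπ : IsBlowup π J)
    (ρs : G →* Aut Xs) (hequiv : ∀ g : G, (ρs g).hom ≫ π = π ≫ (ρ g).hom) (x : Xs) :
    ∃ U : Xs.Opens, IsAffineOpen U ∧ x ∈ U ∧ ∀ g : G, (ρs g).hom ⁻¹ᵁ U = U := by
  classical
  let _ : Fintype G := Fintype.ofFinite G
  -- `X♯` is separated
  haveI : IsProper π := hπ.isProper
  haveI : Xs.IsSeparated := Scheme.isSeparated_of_isSeparated_over π
  -- (1) a `G`-stable affine open `O ∋ π x` of `X`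
  obtain ⟨O, hO, hxO, hOstab⟩ := hcovX (π.base x)
  -- (2) the orbit of `x` lies over `O`
  have hmemV : ∀ g : G, (ρs g).hom.base x ∈ π ⁻¹ᵁ O := by
    intro g
    change x ∈ (ρs g).hom ⁻¹ᵁ π ⁻¹ᵁ O
    rw [← Scheme.Hom.comp_preimage, hequiv g, Scheme.Hom.comp_preimage, hOstab g]
    exact hxO
  -- (3) an affine open of `X♯` containing the orbit
  haveI : IsAffine (O : Scheme.{0}) := hO
  have hπO : IsBlowup (π ∣_ O) (J.comap O.ι) := hπ.restrict O
  let S : Finset (π ⁻¹ᵁ O : Scheme.{0}) :=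
    Finset.univ.image fun g : G => (⟨(ρs g).hom.base x, hmemV g⟩ : (π ⁻¹ᵁ O : Scheme.{0}))
  obtain ⟨U₁, hU₁, hSU₁⟩ := exists_isAffineOpen_forall_mem_of_isBlowup hπO S
  let U₀ : Xs.Opens := (π ⁻¹ᵁ O).ι ''ᵁ U₁
  have hU₀ : IsAffineOpen U₀ := hU₁.image_of_isOpenImmersion _
  have hmem : ∀ g : G, (ρs g).hom.base x ∈ U₀ := by
    intro g
    refine ⟨⟨(ρs g).hom.base x, hmemV g⟩, hSU₁ _ ?_, rfl⟩
    exact Finset.mem_image_of_mem _ (Finset.mem_univ g)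
  -- (4) the intersection of the translates of `U₀`
  let U : Xs.Opens := ⨅ g : G, (ρs g).hom ⁻¹ᵁ U₀
  have hUcoe : ((U : Xs.Opens) : Set Xs) = ⋂ g : G, (ρs g).hom.base ⁻¹' (U₀ : Set Xs) := by
    change (((⨅ g : G, (ρs g).hom ⁻¹ᵁ U₀) : Xs.Opens) : Set Xs) = _
    rw [TopologicalSpace.Opens.coe_iInf]
    rfl
  have hxU : x ∈ U := by
    change x ∈ ((U : Xs.Opens) : Set Xs)
    rw [hUcoe]
    exact Set.mem_iInter.mpr fun g => hmem g
  have hstab : ∀ h : G, (ρs h).hom ⁻¹ᵁ U = U := by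
    intro h
    ext1
    rw [TopologicalSpace.Opens.map_coe, hUcoe, Set.preimage_iInter]
    have e : ∀ g : G, (ρs h).hom.base ⁻¹' ((ρs g).hom.base ⁻¹' (U₀ : Set Xs)) =
        (ρs (g * h)).hom.base ⁻¹' (U₀ : Set Xs) := by
      intro g
      rw [← Set.preimage_comp, map_mul, Aut.Aut_mul_def, Iso.trans_hom]
      rfl
    simp_rw [e]
    exact (Equiv.mulRight h).iInf_comp (g := fun g : G => (ρs g).hom.base ⁻¹' (U₀ : Set Xs))
  have hUaff : IsAffineOpen U := IsAffineOpen.iInf fun g => hU₀.preimage (ρs g).hom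
  exact ⟨U, hUaff, hxU, hstab⟩

end Summit.ResolutionOfSingularities.ResolutionOfSingularities.Theorems.WildQuotientResolution.StableAffineCoverBlowup

end
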